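import Summits.ResolutionOfSingularities.ResolutionOfSingularities.Theorems.FrobeniusClosingSteerBetaNewtonSupport
import Literature.AlgebraicGeometry.Resolution.CharPolyhedronMinimalIsMinimum
import Mathlib.FieldTheory.Perfect
import HarnessLib

/-!
# Crux `Steer` (stmt-ResolutionOfSingularities-16345), chain W4.1, β-LEAF, K-β2♭ part (II), file 4: SQUARE VISIBILITY in
# characteristic `2` — which minimal exponents a twisted square `u·q²` can cancel, and the CLEANING of admissible vertices
# (def-free)

OURS (campaign `res-hironaka`, rung L ★L-G4, slot W4.1; statements about the route's own objects; they replace the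
role of no printed item and are NOT statements of the manuscript under review [claim: Hironaka2017, status:
under-review]; AI review is weaker than expert review). Seat res-D-pv-003 (gen 7), K-β2♭ kernel owner.

The intrinsic replacement for «the coefficients of `u·q²` live in the parity class of `u`» (res-L0-w41-stub-4's (C1)
`…BetaPolygonCanonicalCleaning` in `R⟦X⟧`), for an ABSTRACT regular local ring of characteristic `2` with regular system of
parameters `t`: by Cossart–Piltant Prop. 2.1 every `q` is `Σ_{c ∈ 𝐒(q)} η_c t^c` with UNIT coefficients, hence
`t^ε · q² = Σ η_c² t^(2c + ε)` EXACTLY (Frobenius is additive), and the minimal-exponent calculus applies: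

* `mul_sq_expansion` — `t^ε · (Σ_{c ∈ Q} η_c t^c)² = Σ_{c ∈ Q} η_c² t^(2c + ε)` in characteristic `2`.
* **`exists_two_nsmul_add_eq`** (SQUARE VISIBILITY) — if `Σ_{m ∈ M} γ_m t^m + Σ_{c ∈ Q} η_c² t^(2c + ε)` lies in a monomial ideal
  `(t^b : b ∈ B)`, with `M` an antichain and all `γ_m`, `η_c` units, then every `m₀ ∈ M` above NO `b ∈ B` is of the form
  `2c + ε`, `c ∈ Q` (a square can only cancel a minimal monomial of its own parity class).
* **`exists_add_mul_sq_mem`** (CLEANING) — conversely, over a PERFECT residue field of characteristic `2`: if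
  `f = Σ_{a ∈ A} γ_a t^a`, every `a ∈ A` outside `V` has `t^a ∈ I`, and every `a ∈ V` is ADMISSIBLE (`a = 2c + ε`) with
  `𝔪 · t^a ⊆ I`, then `f + t^ε · q² ∈ I` for some `q`.

[cite: CossartPiltant2019, Prop. 2.1] [cite: Matsumura1987, §30 proof of Thm. 30.9] No Theses file is imported; nothing here is a
route item or a registration.
-/

noncomputable section

-- `Summit.<S>.<S>.…` duplicates the summit name by design (single-problem summit).
set_option linter.dupNamespace false

namespace Summit.ResolutionOfSingularities.ResolutionOfSingularities.Theorems.SwitchingDichotomy.BetaNewton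

open IsLocalRing
open Literature.AlgebraicGeometry.Resolution
open Literature.AlgebraicGeometry.Resolution.CossartPiltant (uPow uPow_mem_span_uPow uPow_mem_span_uPow_of_le minExponents
  uPow_add uPow_nsmul uPow_single mem_span_range_of_mul_uPow_mem)

variable {S : Type} [CommRing S]

/-! ## §1 Twisted squares in characteristic `2` -/

/-- **`t^ε · (Σ η_c t^c)² = Σ η_c² t^(2c + ε)`** in characteristic `2`. [folklore] -/
theorem mul_sq_expansion [CharP S 2] {n : ℕ} {ι : Type*} (t : Fin n → S) (Q : Finset ι) (η : ι → S)
    (e : ι → (Fin n → ℕ)) (ε : Fin n → ℕ) :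
    uPow t ε * (∑ c ∈ Q, η c * uPow t (e c)) ^ 2 = ∑ c ∈ Q, η c ^ 2 * uPow t (2 • e c + ε) := by
  haveI : ExpChar S 2 := ExpChar.prime Nat.prime_two
  rw [sum_pow_char 2 Q, Finset.mul_sum]
  refine Finset.sum_congr rfl fun c _ => ?_
  rw [mul_pow, uPow_add, uPow_nsmul]
  ring

/-! ## §2 Square visibility -/

/-- **SQUARE VISIBILITY.** Let `t` be (part of) a regular system of parameters of a local ring, `M` an ANTICHAIN with unit
coefficients `γ_m`, `Q` a finite set with unit coefficients `η_c`, `ε` a twist exponent. If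
`Σ_{m ∈ M} γ_m t^m + Σ_{c ∈ Q} η_c² t^(2c + ε) ∈ (t^b : b ∈ B)`, then every `m₀ ∈ M` lying above no `b ∈ B` is `2c + ε` for some
`c ∈ Q`. (Take a minimal «bad» exponent `e₀ ≤ m₀` of the combined support; its coefficient lies in `(t)` by the colon formula; a
lone `γ` or a lone `η²` is a unit; so `e₀ ∈ M ∩ (2Q + ε)`, and the antichain forces `e₀ = m₀`.) [cite: CossartPiltant2019, Prop. 2.1] -/
theorem exists_two_nsmul_add_eq [IsLocalRing S] {n : ℕ} {t : Fin n → S} (ht : IsRsopPart t)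
    {M : Finset (Fin n → ℕ)} (hM : IsAntichain (· ≤ ·) (↑M : Set (Fin n → ℕ))) {γ : (Fin n → ℕ) → S}
    (hγ : ∀ m ∈ M, γ m ∉ Ideal.span (Set.range t)) {Q : Finset (Fin n → ℕ)} {η : (Fin n → ℕ) → S}
    (hη : ∀ c ∈ Q, η c ∉ Ideal.span (Set.range t)) (ε : Fin n → ℕ) {B : Set (Fin n → ℕ)}
    (hmem : ∑ m ∈ M, γ m * uPow t m + ∑ c ∈ Q, η c ^ 2 * uPow t (2 • c + ε) ∈ Ideal.span (uPow t '' B))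
    {m₀ : Fin n → ℕ} (hm₀ : m₀ ∈ M) (hbad : ∀ b ∈ B, ¬ b ≤ m₀) : ∃ c ∈ Q, 2 • c + ε = m₀ := by
  classical
  haveI := ht.isRegularLocalRing
  -- the combined support and its «bad» part below `m₀`
  set F : Finset (Fin n → ℕ) := M ∪ Q.image (fun c => 2 • c + ε) with hF
  set D : Finset (Fin n → ℕ) := F.filter (fun e => e ≤ m₀ ∧ ∀ b ∈ B, ¬ b ≤ e) with hD
  have hm₀D : m₀ ∈ D := Finset.mem_filter.mpr ⟨Finset.mem_union_left _ hm₀, le_rfl, hbad⟩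
  obtain ⟨e₀, he₀m₀, he₀min⟩ := D.exists_le_minimal hm₀D
  obtain ⟨he₀F, -, he₀bad⟩ := Finset.mem_filter.mp he₀min.prop
  -- the linear map `c ↦ 2c + ε` is injective
  have hinj : Function.Injective (fun c : Fin n → ℕ => 2 • c + ε) := by
    intro c c' h
    funext l
    have := congrFun h l
    simp only [Pi.add_apply, Pi.smul_apply, smul_eq_mul] at this
    omega
  -- the coefficient of `t^{e₀}`
  set κM : S := if e₀ ∈ M then γ e₀ else 0 with hκM
  set κQ : S := ∑ c ∈ Q.filter (fun c => 2 • c + ε = e₀), η c ^ 2 with hκQ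
  -- isolate: `(κM + κQ) t^{e₀} + rest`, `rest ∈ (t^e : e ∈ F ∖ {e₀})`
  have hsplitM : ∑ m ∈ M, γ m * uPow t m = κM * uPow t e₀ + ∑ m ∈ M.erase e₀, γ m * uPow t m := by
    by_cases he : e₀ ∈ M
    · rw [hκM, if_pos he, ← Finset.add_sum_erase M _ he]
    · rw [hκM, if_neg he, zero_mul, zero_add, Finset.erase_eq_of_notMem he]
  have hsplitQ : ∑ c ∈ Q, η c ^ 2 * uPow t (2 • c + ε) =
      κQ * uPow t e₀ + ∑ c ∈ Q.filter (fun c => ¬ 2 • c + ε = e₀), η c ^ 2 * uPow t (2 • c + ε) := by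
    rw [← Finset.sum_filter_add_sum_filter_not Q (fun c => 2 • c + ε = e₀), hκQ, Finset.sum_mul]
    congr 1
    refine Finset.sum_congr rfl fun c hc => ?_
    rw [(Finset.mem_filter.mp hc).2]
  have hrest : ∑ m ∈ M.erase e₀, γ m * uPow t m +
      ∑ c ∈ Q.filter (fun c => ¬ 2 • c + ε = e₀), η c ^ 2 * uPow t (2 • c + ε) ∈
        Ideal.span (uPow t '' ↑(F.erase e₀)) := by
    refine add_mem (Ideal.sum_mem _ fun m hm => Ideal.mul_mem_left _ _ (uPow_mem_span_uPow t ?_))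
      (Ideal.sum_mem _ fun c hc => Ideal.mul_mem_left _ _ (uPow_mem_span_uPow t ?_))
    · obtain ⟨hne, hmM⟩ := Finset.mem_erase.mp hm
      exact Finset.mem_coe.mpr (Finset.mem_erase.mpr ⟨hne, Finset.mem_union_left _ hmM⟩)
    · obtain ⟨hcQ, hne⟩ := Finset.mem_filter.mp hc
      exact Finset.mem_coe.mpr (Finset.mem_erase.mpr ⟨hne, Finset.mem_union_right _ (Finset.mem_image_of_mem _ hcQ)⟩)
  -- the coefficient `κM + κQ` lies in `(t)` by the colon formula
  have hκ : κM + κQ ∈ Ideal.span (Set.range t) := by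
    have hiso : (κM + κQ) * uPow t e₀ ∈ Ideal.span (uPow t '' (B ∪ ↑(F.erase e₀))) := by
      have : (κM + κQ) * uPow t e₀ =
          (∑ m ∈ M, γ m * uPow t m + ∑ c ∈ Q, η c ^ 2 * uPow t (2 • c + ε)) -
            (∑ m ∈ M.erase e₀, γ m * uPow t m +
              ∑ c ∈ Q.filter (fun c => ¬ 2 • c + ε = e₀), η c ^ 2 * uPow t (2 • c + ε)) := by
        rw [hsplitM, hsplitQ]; ring
      rw [this, Set.image_union, Ideal.span_union]
      exact sub_mem (Ideal.mem_sup_left hmem) (Ideal.mem_sup_right hrest)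
    refine mem_span_range_of_mul_uPow_mem t ht.mem_span_image_of_mul_mem (fun b hb hble => ?_) hiso
    rcases hb with hb | hb
    · exact he₀bad b hb hble
    · obtain ⟨hne, hbF⟩ := Finset.mem_erase.mp (Finset.mem_coe.mp hb)
      -- `b < e₀` would be a smaller bad exponent
      have hbD : b ∈ D := Finset.mem_filter.mpr
        ⟨hbF, hble.trans he₀m₀, fun b' hb' hb'b => he₀bad b' hb' (hb'b.trans hble)⟩
      exact hne (le_antisymm hble (he₀min.le_of_le hbD hble))
  -- case analysis on where `e₀` lives
  have hprime : (Ideal.span (Set.range t)).IsPrime := ht.isPrime_span_range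
  by_cases heQ : ∃ c ∈ Q, 2 • c + ε = e₀
  · obtain ⟨c₀, hc₀Q, hc₀⟩ := heQ
    have hfilt : Q.filter (fun c => 2 • c + ε = e₀) = {c₀} := by
      ext c
      simp only [Finset.mem_filter, Finset.mem_singleton]
      constructor
      · rintro ⟨-, hc⟩
        exact hinj (hc.trans hc₀.symm)
      · rintro rfl
        exact ⟨hc₀Q, hc₀⟩
    have hκQ' : κQ = η c₀ ^ 2 := by rw [hκQ, hfilt, Finset.sum_singleton]
    by_cases heM : e₀ ∈ M
    · -- `e₀, m₀ ∈ M`, `e₀ ≤ m₀` ⇒ `e₀ = m₀`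
      have : e₀ = m₀ := by
        by_contra hne
        exact hM (Finset.mem_coe.mpr heM) (Finset.mem_coe.mpr hm₀) hne he₀m₀
      exact ⟨c₀, hc₀Q, hc₀.trans this⟩
    · -- a lone `η²` would be a unit
      exfalso
      rw [hκM, if_neg heM, zero_add, hκQ'] at hκ
      exact hη c₀ hc₀Q (hprime.mem_of_pow_mem 2 hκ)
  · -- `e₀ ∉ 2Q + ε`: then `e₀ ∈ M` and a lone `γ` would be a unit
    exfalso
    have hfilt : Q.filter (fun c => 2 • c + ε = e₀) = ∅ := by
      ext c
      simp only [Finset.mem_filter, Finset.notMem_empty, iff_false, not_and]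
      exact fun hc h => heQ ⟨c, hc, h⟩
    have hκQ' : κQ = 0 := by rw [hκQ, hfilt, Finset.sum_empty]
    have heM : e₀ ∈ M := by
      rcases Finset.mem_union.mp he₀F with h | h
      · exact h
      · obtain ⟨c, hc, hce⟩ := Finset.mem_image.mp h
        exact absurd ⟨c, hc, hce⟩ heQ
    rw [hκM, if_pos heM, hκQ', add_zero] at hκ
    exact hγ e₀ heM hκ

/-! ## §3 Cleaning of admissible vertices over a perfect residue field -/

/-- The residue field of a local ring of characteristic `2` has characteristic `2`. [folklore] -/
theorem charP_residueField_two [IsLocalRing S] [CharP S 2] : CharP (ResidueField S) 2 := by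
  refine (CharP.charP_iff_prime_eq_zero Nat.prime_two).mpr ?_
  have h : ((2 : ℕ) : S) = 0 := CharP.cast_eq_zero S 2
  rw [← map_natCast (residue S) 2, h, map_zero]

/-- Over a PERFECT residue field of characteristic `2`, every element is a square modulo `𝔪`: `ξ² − γ ∈ 𝔪`. [folklore] -/
theorem exists_sq_sub_mem_maximalIdeal [IsLocalRing S] [CharP S 2] (hperf : PerfectField (ResidueField S)) (γ : S) :
    ∃ ξ : S, ξ ^ 2 - γ ∈ maximalIdeal S := by
  haveI := hperf
  haveI : CharP (ResidueField S) 2 := charP_residueField_two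
  haveI : ExpChar (ResidueField S) 2 := ExpChar.prime Nat.prime_two
  haveI : PerfectRing (ResidueField S) 2 := PerfectField.toPerfectRing 2
  obtain ⟨s, hs⟩ := surjective_frobenius (ResidueField S) 2 (residue S γ)
  obtain ⟨ξ, rfl⟩ := residue_surjective s
  refine ⟨ξ, ?_⟩
  rw [← residue_eq_zero_iff, map_sub, map_pow, sub_eq_zero]
  simpa [frobenius_def] using hs

/-- **CLEANING of admissible vertices.** Let `f = Σ_{a ∈ A} γ_a t^a`; suppose every `a ∈ A` with `¬ P a` has `t^a ∈ I`, and
every `a ∈ A` with `P a` («vertex exponent») is ADMISSIBLE for the twist `ε` (`a = 2c + ε` for some `c`) and has `𝔪 · t^a ⊆ I`.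
Over a perfect residue field of characteristic `2` there is a cleaning `q` with `f + t^ε · q² ∈ I` (take
`q = Σ ξ_a t^(c_a)` with `ξ_a² ≡ γ_a`; then `γ_a + ξ_a² ≡ 2γ_a = 0 (mod 𝔪)`). [cite: Matsumura1987, §30 proof of Thm. 30.9] -/
theorem exists_add_mul_sq_mem [IsLocalRing S] [CharP S 2] (hperf : PerfectField (ResidueField S)) {n : ℕ}
    (t : Fin n → S) {I : Ideal S} {A : Finset (Fin n → ℕ)} {γ : (Fin n → ℕ) → S} {f : S}
    (hf : f = ∑ a ∈ A, γ a * uPow t a) (P : (Fin n → ℕ) → Prop) [DecidablePred P]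
    (hI : ∀ a ∈ A, ¬ P a → uPow t a ∈ I) (hV : ∀ a ∈ A, P a → ∀ s ∈ maximalIdeal S, s * uPow t a ∈ I)
    (ε : Fin n → ℕ) (hadm : ∀ a ∈ A, P a → ∃ c : Fin n → ℕ, 2 • c + ε = a) :
    ∃ q : S, f + uPow t ε * q ^ 2 ∈ I := by
  classical
  -- choose half-exponents and square roots of the coefficients
  have hc : ∀ a : Fin n → ℕ, ∃ c : Fin n → ℕ, a ∈ A → P a → 2 • c + ε = a := fun a => by
    by_cases h : a ∈ A ∧ P a
    · obtain ⟨c, hc⟩ := hadm a h.1 h.2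
      exact ⟨c, fun _ _ => hc⟩
    · exact ⟨0, fun ha hP => absurd ⟨ha, hP⟩ h⟩
  choose c hc using hc
  have hξ : ∀ a : Fin n → ℕ, ∃ ξ : S, ξ ^ 2 - γ a ∈ maximalIdeal S := fun a =>
    exists_sq_sub_mem_maximalIdeal hperf (γ a)
  choose ξ hξ using hξ
  refine ⟨∑ a ∈ A.filter P, ξ a * uPow t (c a), ?_⟩
  rw [mul_sq_expansion t (A.filter P) ξ c ε]
  have hsq : ∑ a ∈ A.filter P, ξ a ^ 2 * uPow t (2 • c a + ε) = ∑ a ∈ A.filter P, ξ a ^ 2 * uPow t a := by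
    refine Finset.sum_congr rfl fun a ha => ?_
    obtain ⟨haA, hPa⟩ := Finset.mem_filter.mp ha
    rw [hc a haA hPa]
  rw [hsq, hf, ← Finset.sum_filter_add_sum_filter_not A P, add_assoc, add_comm (∑ a ∈ A.filter (fun a => ¬ P a), _),
    ← add_assoc, ← Finset.sum_add_distrib]
  refine add_mem (Ideal.sum_mem _ fun a ha => ?_) (Ideal.sum_mem _ fun a ha => ?_)
  · -- vertex terms: `(γ_a + ξ_a²) t^a` with `γ_a + ξ_a² ∈ 𝔪`
    obtain ⟨haA, hPa⟩ := Finset.mem_filter.mp ha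
    rw [← add_mul]
    refine hV a haA hPa _ ?_
    have h2 : (2 : S) = 0 := by
      have := CharP.cast_eq_zero S 2
      simpa using this
    have : γ a + ξ a ^ 2 = (ξ a ^ 2 - γ a) + 2 * γ a := by ring
    rw [this, h2, zero_mul, add_zero]
    exact hξ a
  · obtain ⟨haA, hPa⟩ := Finset.mem_filter.mp ha
    exact Ideal.mul_mem_left _ _ (hI a haA hPa)

end Summit.ResolutionOfSingularities.ResolutionOfSingularities.Theorems.SwitchingDichotomy.BetaNewton

end
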